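import Summits.HubbardSuperconductivity.HubbardSuperconductivity.Theorems.WeakCouplingBCSKlLindhardEnclosureFloorStructural

/-!
# KL-MARGIN-SCAN reader (22) «kernel-lindhard-enclosure» — RECORDS SOUNDNESS, layer 1: point records and the cosine RANGE tests

First analytic layer under the seven rule predicates of `…FloorRules` / `…CeilRulesInRoot`: every rule reads the cell data `Params.cell`,
whose cosine ranges come from (i) the POINT records `Params.mkX/mkY` (Taylor floor/ceiling numerators of `cos (z/U)` and of the shifted
`cos ((z+qᵢ)/U)`, Cos §1) and (ii) the conservative RANGE tests `mayMinZ`/`mayMaxZ` with `cosInfZ`/`cosSupZ` (Records §2).  Proved here: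
the point records enclose the true cosines (`mkX_lo_le`, `le_mkX_hi`, primed and `mkY` twins); `cos` on an interval free of odd (resp. even)
multiples of `π` attains its minimum (resp. maximum) at an endpoint (`cos_ge_min_of_window`, `cos_le_max_of_window`); and the integer tests
are sound: **`cosInfZ_le`** — for admissible `P` and ANY abscissa interval, `cosInfZ/2^40 ≤ cos` on it (the test `mayMinZ = false` excludes
every odd multiple of `π` by the certified brackets `piLoZ < πU < piUpZ`); **`le_cosSupZ`** — the same for the supremum PROVIDED the interval
lies within `[−2·piLoZ, 2·piLoZ]/U ⊂ (−2π, 2π)` (exactly what admissibility gives inside the root square: `|qᵢ| + Xz ≤ 2·piLoZ`), where the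
only even multiple of `π` is `0`.  Next layers (not here): band enclosures via the antitonicity guards, shell statuses, then the rules.
Honest framing: elementary real analysis about `cos`; nothing in this file asserts a KL margin at any `t′ ≠ 0`, `K₃`, `U₀`, the window or
B1g dominance; a Kohn–Luttinger instability statement is not ODLRO and nothing here proves superconductivity in the Hubbard model.
(p1 g25, 2026-08-29.)
-/

noncomputable section

set_option linter.dupNamespace false

namespace Summit.HubbardSuperconductivity.HubbardSuperconductivity.Theorems.KlLindhardEnclosure

open Real Set MeasureTheory Literature.MathematicalPhysics.QuantumLattice
open Summit.HubbardSuperconductivity.HubbardSuperconductivity.Theorems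

/-! ## §1 `cos` on windows free of critical points -/

/-- On a sub-interval of `(−π, π)` (no odd multiple of `π`), `cos` is at least its smaller endpoint value. -/
theorem cos_ge_min_of_Icc_subset {x0 x1 x : ℝ} (h0 : -π < x0) (h1 : x1 < π) (hx0 : x0 ≤ x) (hx1 : x ≤ x1) :
    min (Real.cos x0) (Real.cos x1) ≤ Real.cos x := by
  by_cases hx : 0 ≤ x
  · have := Real.cos_le_cos_of_nonneg_of_le_pi hx h1.le hx1
    exact (min_le_right _ _).trans this
  · push Not at hx
    have h := Real.cos_le_cos_of_nonneg_of_le_pi (x := -x) (y := -x0) (by linarith) (by linarith) (by linarith)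
    rw [Real.cos_neg, Real.cos_neg] at h
    exact (min_le_left _ _).trans h

/-- Window version: if `cos (y − c) = cos y` for all `y` (`c ∈ {0, ±2π}`) and `[x0, x1] ⊂ (c − π, c + π)`, the minimum is at an endpoint. -/
theorem cos_ge_min_of_window {c x0 x1 x : ℝ} (hc : ∀ y, Real.cos (y - c) = Real.cos y) (h0 : c - π < x0) (h1 : x1 < c + π)
    (hx0 : x0 ≤ x) (hx1 : x ≤ x1) : min (Real.cos x0) (Real.cos x1) ≤ Real.cos x := by
  have h := cos_ge_min_of_Icc_subset (x0 := x0 - c) (x1 := x1 - c) (x := x - c) (by linarith) (by linarith) (by linarith) (by linarith)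
  simpa only [hc] using h

/-- On a sub-interval of `(0, 2π)` (no even multiple of `π`), `cos` is at most its larger endpoint value. -/
theorem cos_le_max_of_Icc_subset {x0 x1 x : ℝ} (h0 : 0 < x0) (h1 : x1 < 2 * π) (hx0 : x0 ≤ x) (hx1 : x ≤ x1) :
    Real.cos x ≤ max (Real.cos x0) (Real.cos x1) := by
  by_cases hx : x ≤ π
  · have := Real.cos_le_cos_of_nonneg_of_le_pi h0.le hx hx0
    exact this.trans (le_max_left _ _)
  · push Not at hx
    have h := Real.cos_le_cos_of_nonneg_of_le_pi (x := 2 * π - x1) (y := 2 * π - x) (by linarith) (by linarith) (by linarith)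
    have e1 : Real.cos (2 * π - x1) = Real.cos x1 := by rw [← Real.cos_sub_two_pi (2 * π - x1)]; ring_nf; exact Real.cos_neg _
    have e2 : Real.cos (2 * π - x) = Real.cos x := by rw [← Real.cos_sub_two_pi (2 * π - x)]; ring_nf; exact Real.cos_neg _
    rw [e1, e2] at h
    exact h.trans (le_max_right _ _)

/-- Window version for the maximum: `[x0, x1] ⊂ (c, c + 2π)` with `cos (y − c) = cos y`. -/
theorem cos_le_max_of_window {c x0 x1 x : ℝ} (hc : ∀ y, Real.cos (y - c) = Real.cos y) (h0 : c < x0) (h1 : x1 < c + 2 * π)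
    (hx0 : x0 ≤ x) (hx1 : x ≤ x1) : Real.cos x ≤ max (Real.cos x0) (Real.cos x1) := by
  have h := cos_le_max_of_Icc_subset (x0 := x0 - c) (x1 := x1 - c) (x := x - c) (by linarith) (by linarith) (by linarith) (by linarith)
  simpa only [hc] using h

/-! ## §2 Admissibility: the certified `π`-brackets as real inequalities -/

/-- Admissible ⇒ `piLoZ/U < π` (as `piLoZ < π·U`). -/
theorem Params.piLoZ_lt_pi_mul (P : Params) (hP : P.admissible = true) : (P.piLoZ : ℝ) < π * (P.U : ℝ) := by
  simp only [Params.admissible, Bool.and_eq_true, decide_eq_true_eq] at hP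
  have hU : 0 < P.U := hP.1.1.1.1.1.1.2
  have h1 : P.piLoZ * 1000000 ≤ 3141592 * P.U := hP.1.1.1.1.1.2
  have hU' : (0 : ℝ) < (P.U : ℝ) := by exact_mod_cast hU
  have h1' : (P.piLoZ : ℝ) * 1000000 ≤ 3141592 * (P.U : ℝ) := by exact_mod_cast h1
  have hpi := Real.pi_gt_d6
  nlinarith

/-- Admissible ⇒ `π < piUpZ/U` (as `π·U < piUpZ`). -/
theorem Params.pi_mul_lt_piUpZ (P : Params) (hP : P.admissible = true) : π * (P.U : ℝ) < (P.piUpZ : ℝ) := by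
  simp only [Params.admissible, Bool.and_eq_true, decide_eq_true_eq] at hP
  have hU : 0 < P.U := hP.1.1.1.1.1.1.2
  have h1 : 3141593 * P.U ≤ P.piUpZ * 1000000 := hP.1.1.1.1.2
  have hU' : (0 : ℝ) < (P.U : ℝ) := by exact_mod_cast hU
  have h1' : (3141593 : ℝ) * (P.U : ℝ) ≤ (P.piUpZ : ℝ) * 1000000 := by exact_mod_cast h1
  have hpi := Real.pi_lt_d6
  nlinarith

/-! ## §3 Point records enclose the true cosines -/

/-- `(mkX z).lo / 2^40 ≤ cos (z/U)`. -/
theorem Params.mkX_lo_le (P : Params) (hU : 0 < P.U) (z : ℤ) : (((P.mkX z).lo : ℤ) : ℝ) / 2 ^ 40 ≤ Real.cos ((z : ℝ) / (P.U : ℝ)) :=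
  cosFlZ_le_cos (by decide) z P.U hU

/-- `cos (z/U) ≤ (mkX z).hi / 2^40`. -/
theorem Params.le_mkX_hi (P : Params) (hU : 0 < P.U) (z : ℤ) : Real.cos ((z : ℝ) / (P.U : ℝ)) ≤ (((P.mkX z).hi : ℤ) : ℝ) / 2 ^ 40 :=
  cos_le_cosClZ (by decide) z P.U hU

/-- `(mkX z).lo' / 2^40 ≤ cos ((z + q₁)/U)`. -/
theorem Params.mkX_lo'_le (P : Params) (hU : 0 < P.U) (z : ℤ) :
    (((P.mkX z).lo' : ℤ) : ℝ) / 2 ^ 40 ≤ Real.cos (((z + P.q1z : ℤ) : ℝ) / (P.U : ℝ)) :=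
  cosFlZ_le_cos (by decide) (z + P.q1z) P.U hU

/-- `cos ((z + q₁)/U) ≤ (mkX z).hi' / 2^40`. -/
theorem Params.le_mkX_hi' (P : Params) (hU : 0 < P.U) (z : ℤ) :
    Real.cos (((z + P.q1z : ℤ) : ℝ) / (P.U : ℝ)) ≤ (((P.mkX z).hi' : ℤ) : ℝ) / 2 ^ 40 :=
  cos_le_cosClZ (by decide) (z + P.q1z) P.U hU

/-- `(mkY z).lo / 2^40 ≤ cos (z/U)`. -/
theorem Params.mkY_lo_le (P : Params) (hU : 0 < P.U) (z : ℤ) : (((P.mkY z).lo : ℤ) : ℝ) / 2 ^ 40 ≤ Real.cos ((z : ℝ) / (P.U : ℝ)) :=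
  cosFlZ_le_cos (by decide) z P.U hU

/-- `cos (z/U) ≤ (mkY z).hi / 2^40`. -/
theorem Params.le_mkY_hi (P : Params) (hU : 0 < P.U) (z : ℤ) : Real.cos ((z : ℝ) / (P.U : ℝ)) ≤ (((P.mkY z).hi : ℤ) : ℝ) / 2 ^ 40 :=
  cos_le_cosClZ (by decide) z P.U hU

/-- `(mkY z).lo' / 2^40 ≤ cos ((z + q₂)/U)`. -/
theorem Params.mkY_lo'_le (P : Params) (hU : 0 < P.U) (z : ℤ) :
    (((P.mkY z).lo' : ℤ) : ℝ) / 2 ^ 40 ≤ Real.cos (((z + P.q2z : ℤ) : ℝ) / (P.U : ℝ)) :=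
  cosFlZ_le_cos (by decide) (z + P.q2z) P.U hU

/-- `cos ((z + q₂)/U) ≤ (mkY z).hi' / 2^40`. -/
theorem Params.le_mkY_hi' (P : Params) (hU : 0 < P.U) (z : ℤ) :
    Real.cos (((z + P.q2z : ℤ) : ℝ) / (P.U : ℝ)) ≤ (((P.mkY z).hi' : ℤ) : ℝ) / 2 ^ 40 :=
  cos_le_cosClZ (by decide) (z + P.q2z) P.U hU

/-! ## §4 Soundness of the integer range tests -/

/-- What `mayMinZ = false` certifies, as integer facts. -/
theorem Params.mayMinZ_false (P : Params) {u0 u1 : ℤ} (h : P.mayMinZ u0 u1 = false) :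
    (P.piUpZ ≤ u0 ∨ u1 ≤ P.piLoZ) ∧ (-P.piLoZ ≤ u0 ∨ u1 ≤ -P.piUpZ) ∧ u1 < 3 * P.piLoZ ∧ -(3 * P.piLoZ) < u0 := by
  unfold Params.mayMinZ at h
  simp only [Bool.or_eq_false_iff, Bool.and_eq_false_iff, decide_eq_false_iff_not, not_lt, not_le] at h
  omega

/-- What `mayMaxZ = false` certifies (the part used here): `0 ∉ [u0, u1]`. -/
theorem Params.mayMaxZ_false (P : Params) {u0 u1 : ℤ} (h : P.mayMaxZ u0 u1 = false) : 0 < u0 ∨ u1 < 0 := by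
  unfold Params.mayMaxZ at h
  simp only [Bool.or_eq_false_iff, Bool.and_eq_false_iff, decide_eq_false_iff_not, not_lt, not_le] at h
  omega

/-- **`cosInfZ` IS SOUND** (any interval): for admissible `P`, endpoint minorants `l0/2^40 ≤ cos (u0/U)`, `l1/2^40 ≤ cos (u1/U)` and any
`x ∈ [u0/U, u1/U]`: `cosInfZ u0 u1 l0 l1 / 2^40 ≤ cos x`. -/
theorem Params.cosInfZ_le (P : Params) (hP : P.admissible = true) {u0 u1 l0 l1 : ℤ}
    (hl0 : ((l0 : ℤ) : ℝ) / 2 ^ 40 ≤ Real.cos ((u0 : ℝ) / (P.U : ℝ))) (hl1 : ((l1 : ℤ) : ℝ) / 2 ^ 40 ≤ Real.cos ((u1 : ℝ) / (P.U : ℝ)))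
    {x : ℝ} (hx0 : (u0 : ℝ) / (P.U : ℝ) ≤ x) (hx1 : x ≤ (u1 : ℝ) / (P.U : ℝ)) :
    ((P.cosInfZ u0 u1 l0 l1 : ℤ) : ℝ) / 2 ^ 40 ≤ Real.cos x := by
  have hU : 0 < P.U := P.U_pos_of_admissible hP
  have hU' : (0 : ℝ) < (P.U : ℝ) := by exact_mod_cast hU
  have hlo := P.piLoZ_lt_pi_mul hP
  have hup := P.pi_mul_lt_piUpZ hP
  unfold Params.cosInfZ
  split_ifs with hm
  · simp only [D, Int.cast_neg, Int.cast_pow, Int.cast_ofNat]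
    have := Real.neg_one_le_cos x
    rw [neg_div, div_self (by positivity)]
    exact this
  · have hm' : P.mayMinZ u0 u1 = false := by simpa using hm
    obtain ⟨h1, h2, h3, h4⟩ := P.mayMinZ_false hm'
    have hmin : ((min l0 l1 : ℤ) : ℝ) / 2 ^ 40 ≤ min (Real.cos ((u0 : ℝ) / P.U)) (Real.cos ((u1 : ℝ) / P.U)) := by
      rw [le_min_iff]
      constructor
      · refine le_trans ?_ hl0
        exact div_le_div_of_nonneg_right (by exact_mod_cast min_le_left l0 l1) (by positivity)
      · refine le_trans ?_ hl1
        exact div_le_div_of_nonneg_right (by exact_mod_cast min_le_right l0 l1) (by positivity)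
    refine hmin.trans ?_
    -- real versions of the integer facts
    have h3' : (u1 : ℝ) < 3 * (P.piLoZ : ℝ) := by exact_mod_cast h3
    have h4' : -(3 * (P.piLoZ : ℝ)) < (u0 : ℝ) := by exact_mod_cast h4
    have hx0' : (u0 : ℝ) ≤ x * (P.U : ℝ) := by rwa [div_le_iff₀ hU'] at hx0
    have hx1' : x * (P.U : ℝ) ≤ (u1 : ℝ) := by rwa [le_div_iff₀ hU'] at hx1
    rcases h1 with ha | ha
    · -- window (π, 3π): shift by 2π
      have ha' : (P.piUpZ : ℝ) ≤ (u0 : ℝ) := by exact_mod_cast ha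
      refine cos_ge_min_of_window (c := 2 * π) (fun y => Real.cos_sub_two_pi y) ?_ ?_ hx0 hx1
      · rw [lt_div_iff₀ hU']; nlinarith
      · rw [div_lt_iff₀ hU']; nlinarith
    · rcases h2 with hb | hb
      · -- window (−π, π)
        have ha' : (u1 : ℝ) ≤ (P.piLoZ : ℝ) := by exact_mod_cast ha
        have hb' : -(P.piLoZ : ℝ) ≤ (u0 : ℝ) := by exact_mod_cast hb
        refine cos_ge_min_of_window (c := 0) (fun y => by rw [sub_zero]) ?_ ?_ hx0 hx1
        · rw [lt_div_iff₀ hU']; nlinarith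
        · rw [div_lt_iff₀ hU']; nlinarith
      · -- window (−3π, −π): shift by −2π
        have hb' : (u1 : ℝ) ≤ -(P.piUpZ : ℝ) := by exact_mod_cast hb
        refine cos_ge_min_of_window (c := -(2 * π)) (fun y => by rw [sub_neg_eq_add, Real.cos_add_two_pi]) ?_ ?_ hx0 hx1
        · rw [lt_div_iff₀ hU']; nlinarith
        · rw [div_lt_iff₀ hU']; nlinarith

/-- **`cosSupZ` IS SOUND inside `[−2·piLoZ, 2·piLoZ]/U`**: for admissible `P`, endpoint majorants and any `x ∈ [u0/U, u1/U]` with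
`−2·piLoZ ≤ u0`, `u1 ≤ 2·piLoZ`: `cos x ≤ cosSupZ u0 u1 h0 h1 / 2^40`. -/
theorem Params.le_cosSupZ (P : Params) (hP : P.admissible = true) {u0 u1 h0 h1 : ℤ}
    (hh0 : Real.cos ((u0 : ℝ) / (P.U : ℝ)) ≤ ((h0 : ℤ) : ℝ) / 2 ^ 40) (hh1 : Real.cos ((u1 : ℝ) / (P.U : ℝ)) ≤ ((h1 : ℤ) : ℝ) / 2 ^ 40)
    (hr0 : -(2 * P.piLoZ) ≤ u0) (hr1 : u1 ≤ 2 * P.piLoZ)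
    {x : ℝ} (hx0 : (u0 : ℝ) / (P.U : ℝ) ≤ x) (hx1 : x ≤ (u1 : ℝ) / (P.U : ℝ)) :
    Real.cos x ≤ ((P.cosSupZ u0 u1 h0 h1 : ℤ) : ℝ) / 2 ^ 40 := by
  have hU : 0 < P.U := P.U_pos_of_admissible hP
  have hU' : (0 : ℝ) < (P.U : ℝ) := by exact_mod_cast hU
  have hlo := P.piLoZ_lt_pi_mul hP
  unfold Params.cosSupZ
  split_ifs with hm
  · simp only [D, Int.cast_pow, Int.cast_ofNat]
    rw [div_self (by positivity)]
    exact Real.cos_le_one x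
  · have hm' : P.mayMaxZ u0 u1 = false := by simpa using hm
    have h01 := P.mayMaxZ_false hm'
    have hmax : max (Real.cos ((u0 : ℝ) / P.U)) (Real.cos ((u1 : ℝ) / P.U)) ≤ ((max h0 h1 : ℤ) : ℝ) / 2 ^ 40 := by
      rw [max_le_iff]
      constructor
      · refine hh0.trans ?_
        exact div_le_div_of_nonneg_right (by exact_mod_cast le_max_left h0 h1) (by positivity)
      · refine hh1.trans ?_
        exact div_le_div_of_nonneg_right (by exact_mod_cast le_max_right h0 h1) (by positivity)
    refine le_trans ?_ hmax
    have hr0' : -(2 * (P.piLoZ : ℝ)) ≤ (u0 : ℝ) := by exact_mod_cast hr0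
    have hr1' : (u1 : ℝ) ≤ 2 * (P.piLoZ : ℝ) := by exact_mod_cast hr1
    have hx0' : (u0 : ℝ) ≤ x * (P.U : ℝ) := by rwa [div_le_iff₀ hU'] at hx0
    have hx1' : x * (P.U : ℝ) ≤ (u1 : ℝ) := by rwa [le_div_iff₀ hU'] at hx1
    rcases h01 with ha | ha
    · -- window (0, 2π)
      have ha' : (0 : ℝ) < (u0 : ℝ) := by exact_mod_cast ha
      refine cos_le_max_of_window (c := 0) (fun y => by rw [sub_zero]) ?_ ?_ hx0 hx1
      · rw [lt_div_iff₀ hU']; nlinarith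
      · rw [div_lt_iff₀ hU']; nlinarith
    · -- window (−2π, 0): shift by −2π
      have ha' : (u1 : ℝ) < 0 := by exact_mod_cast ha
      refine cos_le_max_of_window (c := -(2 * π)) (fun y => by rw [sub_neg_eq_add, Real.cos_add_two_pi]) ?_ ?_ hx0 hx1
      · rw [lt_div_iff₀ hU']; nlinarith
      · rw [div_lt_iff₀ hU']; nlinarith

end Summit.HubbardSuperconductivity.HubbardSuperconductivity.Theorems.KlLindhardEnclosure

end
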